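import Summits.PneNP.PneNP.Theorems.SoloBlindAnchor
import Literature.Computability.Complexity.LogAdviceCollapse
import HarnessLib

/-!
# Solo (blind) — what a proof must do: equivalent forms of the summit constant

Necessary-side calibrations of the summit constant `Summit.PneNP` (`= ∃ L ∈ NP, L ∉ P`): every
proof of `P ≠ NP` is at the same time a proof of each right-hand side below, all of them
reproduced in the tree's Literature library for `¬ (NP ⊆ P)` and here wired to the summit constant.
By Karp–Lipton's `P/log` collapse (STOC 1980, §6; reproduced in the tree as
`Literature.Computability.Complexity.NP_subset_logAdvice_iff : NP ⊆ P/log ↔ NP ⊆ P`, through the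
`NP`-complete length-paddable language `onesZeroPad SAT`), *every* proof of `P ≠ NP` proves the
formally stronger, mildly non-uniform lower bound `NP ⊄ P/(c·log n + c)`:

* `pneNP_iff_not_NP_subset_logAdvice : PneNP ↔ ¬ (NP ⊆ P/log)`;
* `pneNP_iff_onesZeroPad_SAT_not_mem_logAdvice : PneNP ↔ onesZeroPad SAT ∉ P/log` — one explicit
  `NP`-complete language against polynomial time with `O(log n)` advice bits.

`P/log` is written out exactly as in `LogAdviceCollapse.lean` (no new definition):
`∃ L' ∈ P, ∃ a : ℕ → {0,1}*, ∃ c, (∀ n, |a n| ≤ c·⌊log₂ n⌋ + c) ∧ ∀ x, (x ∈ L ↔ ⟨x, a |x|⟩ ∈ L')`.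
The first genuinely non-uniform strengthening, `NP ⊄ P/poly`, is NOT implied (it is a sufficient
hypothesis, `pneNP_of_not_NP_subset_PPoly` in `SoloBlindCorridorMap.lean`).

Two further equivalent forms of `¬ (NP ⊆ P)` already stand in the tree's Literature library and
are not re-wired here: a worst-case one-way function exists
(`Literature.Computability.Complexity.not_NP_subset_P_iff_exists_oneWay`, Grollmann–Selman 1988 /
Rothe 2005 Prop. 8.35) and some `NP` search problem has arbitrarily costly necessary witnesses
(`Literature.Computability.MetaComplexity.not_NP_subset_P_iff_exists_costly_witnesses`, Levin 1973).
-/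

namespace Summit.PneNP.PneNP.Theorems.SoloBlind

open Computability
open Literature.Computability.Complexity Literature.Computability.MetaComplexity

/-- `PneNP ↔ ¬ (NP ⊆ P)`. -/
theorem pneNP_iff_not_NP_subset_P : PneNP ↔ ¬ (Nondeterministic.NP ⊆ Classes.P) := by
  rw [pneNP_iff_P_ne_NP]
  constructor
  · intro hne hsub
    exact hne (Set.Subset.antisymm P_subset_NP_holds hsub)
  · intro hns heq
    exact hns (heq ▸ subset_rfl)

/-- **`P ≠ NP` iff `NP ⊄ P/log`**: any proof of the summit defeats `c·log n + c` bits of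
polynomial-time advice for free (Karp–Lipton 1980, §6, via the tree's `NP_subset_logAdvice_iff`).
[cite: KarpLipton1980, §6 (P/log)] -/
theorem pneNP_iff_not_NP_subset_logAdvice :
    PneNP ↔ ¬ (∀ L ∈ Nondeterministic.NP, ∃ L' ∈ Classes.P, ∃ a : ℕ → List Bool, ∃ c : ℕ,
      (∀ n, (a n).length ≤ c * Nat.log 2 n + c) ∧ ∀ x, x ∈ L ↔ boolPair x (a x.length) ∈ L') := by
  rw [pneNP_iff_not_NP_subset_P, NP_subset_logAdvice_iff]

/-- **`P ≠ NP` iff the padded satisfiability language `onesZeroPad SAT = {1ⁱ 0 φ : φ ∈ SAT}` is not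
decidable in polynomial time with `O(log n)` advice bits** (Karp–Lipton 1980, §6, via the tree's
`onesZeroPad_SAT_mem_logAdvice_iff`). [cite: KarpLipton1980, §6 (P/log)] -/
theorem pneNP_iff_onesZeroPad_SAT_not_mem_logAdvice :
    PneNP ↔ ¬ (∃ T' ∈ Classes.P, ∃ a : ℕ → List Bool, ∃ c : ℕ,
      (∀ n, (a n).length ≤ c * Nat.log 2 n + c) ∧
        ∀ y, y ∈ onesZeroPad SAT ↔ boolPair y (a y.length) ∈ T') := by
  rw [pneNP_iff_not_NP_subset_P, ← onesZeroPad_SAT_mem_logAdvice_iff]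

end Summit.PneNP.PneNP.Theorems.SoloBlind
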